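import Summits.NavierStokesRegularity.NavierStokesRegularity.Theorems.ExtremiserTransienceNearExtremalTransienceDSSPerFlow
import Summits.NavierStokesRegularity.NavierStokesRegularity.Theorems.ExtremiserTransienceNearExtremalTransienceExtremiserLiouvillePlateau
import HarnessLib

/-!
# Crux `ExtremiserTransience.NearExtremalTransience` (stmt-NavierStokesRegularity-21883) — K1-bypass companion:
# ANALYTIC FIELDS NEVER ATTAIN `κ⋆` IN THE `L²` CLASS, hence the DSS stratum is log-mean sub-extremal
# flow by flow WITHOUT the non-attainment hypothesis `hna`

Author: ideator seat `ns-idea-10` (generation 6, lens «rescuer»).  SORRY-FREE support file (crux workfile, not a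
Theorems proposal; a prover may land it verbatim).  No summit, crux or rung of the ladder is proved here; NS
regularity is OPEN.

THE OBSERVATION.  `Theorems/…DSSPerFlow.lean` (ns-et-p1 g2) proves, under the OPEN STATIC hypothesis `hna` («the sharp
stretching inequality is never attained in the admissible `L²` class»), that every classical Leray–Hopf flow which is
discretely self-similar about its blow-up time is log-mean sub-extremal with its own `θ_u < 1`
(`dss_perFlow_logMean_of_notAttained`).  `hna` is applied there exactly once — to a SLICE `u(t)`.  But a slice of a
classical flow at a time `t > 0` is REAL-ANALYTIC in space (Lemarié-Rieusset 2016 Thm. 9.12; the tree's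
`analytic_of_bounded_mild_L3_holds` / `lemarieRieusset2016_local_analyticity_holds`), and for ANALYTIC fields
non-attainment is a THEOREM: by `norm_eq_of_analytic_extremal` (p639524, ns-el-k1b g2 — every analytic extended
extremiser has CONSTANT SPEED `‖v‖ ≡ M`) an analytic `L²`-class field with `0 < M√Z√P` attaining equality would have
`‖v‖ ≡ M > 0` on `ℝ³`, contradicting `D⁰v ∈ L²` (Lebesgue measure of `ℝ³` is infinite).  Hence:

* `strict_of_analytic` — `hna` restricted to analytic fields HOLDS (kernel-checked);
* `minimalCoeff_lt_sharp_of_analyticSlices`, `dss_periodMass_lt_of_analyticSlices`,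
  `dss_perFlow_logMean_of_analyticSlices` — the three DSS-stratum theorems with `hna` REPLACED by the regularity
  hypothesis `hA : ∀ t ∈ Ioo 0 T, AnalyticOnNhd ℝ (u t) univ` (proofs = the originals, verbatim up to the one line).

WHAT REMAINS for full unconditionality (an M-sized PROVER task, all ingredients in the tree): `hA` for classical
Leray–Hopf rapidly-decaying-datum flows on `[0,T)` — slices are bounded and in every `H^k` on `[0,t']` by the Tao
cover (`stub_taoCover`, as used in the DSS file), hence in `L³` and duality-mild (`isMildNSSolutionOn_of_memLp_three`,
after a time shift so the open interval contains `0`), so `analytic_of_bounded_mild_L3_holds` yields an analytic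
classical representative `w` with `w t =ᵐ u t`, and `Continuous.ae_eq_iff_eq` identifies `u t = w t`.  The residue
named «(i) ATTAINMENT of κ⋆» in the DSS file's docstring then disappears from the DSS stratum; residue (ii)
(UNIFORMITY of `θ_u` over DSS flows) is untouched. [folklore]
-/

noncomputable section

open Set Filter Topology MeasureTheory
open scoped InnerProductSpace RealInnerProductSpace ENNReal NNReal ContDiff
open Literature.Analysis.FluidPDE

namespace Summit.NavierStokesRegularity.NavierStokesRegularity.Cruxes.NearExtremalTransience.ExtremiserLiouville.K1Bypass

set_option linter.dupNamespace false
set_option linter.unusedVariables false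
set_option linter.style.longLine false
set_option linter.style.setOption false

open Summit.NavierStokesRegularity.NavierStokesRegularity.Theorems
open Summit.NavierStokesRegularity.NavierStokesRegularity.Theorems.DepletionLadder
open Summit.NavierStokesRegularity.NavierStokesRegularity.Theorems.RungReynoldsOne
open Summit.NavierStokesRegularity.NavierStokesRegularity.Theorems.ExtremiserLiouville

/-- **Analytic fields never attain `κ⋆` in the `L²` class**: `hna` of the DSS file, restricted to real-analytic `v`,
HOLDS — by `norm_eq_of_analytic_extremal` (constant speed) and `D⁰v ∈ L²` on the infinite-measure space `ℝ³`. [folklore] -/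
theorem strict_of_analytic :
    (∀ (v : EuclideanSpace ℝ (Fin 3) → EuclideanSpace ℝ (Fin 3)) (M B : ℝ), ContDiff ℝ (⊤ : ℕ∞) v → Literature.Analysis.FluidPDE.VectorCalculus.IsDivFree v → (∀ x, ‖v x‖ ≤ M) → (∀ x, ‖fderiv ℝ v x‖ ≤ B) → (∫⁻ x, ‖iteratedFDeriv ℝ 0 v x‖ₑ ^ 2 < ⊤) → (∫⁻ x, ‖iteratedFDeriv ℝ 1 v x‖ₑ ^ 2 < ⊤) → (∫⁻ x, ‖iteratedFDeriv ℝ 2 v x‖ₑ ^ 2 < ⊤) → AnalyticOnNhd ℝ v univ → 0 < M * Real.sqrt (∫ x, ‖curl v x‖ ^ 2) * Real.sqrt (∫ x, frobeniusNormSq (fderiv ℝ (curl v) x)) → |∫ x, ⟪curl v x, fderiv ℝ v x (curl v x)⟫_ℝ| < (sInf {κ : ℝ | (∀ (v : EuclideanSpace ℝ (Fin 3) → EuclideanSpace ℝ (Fin 3)) (M B : ℝ), ContDiff ℝ (⊤ : ℕ∞) v → Literature.Analysis.FluidPDE.VectorCalculus.IsDivFree v → (∀ x, ‖v x‖ ≤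 M) → (∀ x, ‖fderiv ℝ v x‖ ≤ B) → (∫⁻ x, ‖iteratedFDeriv ℝ 0 v x‖ₑ ^ 2 < ⊤) → (∫⁻ x, ‖iteratedFDeriv ℝ 1 v x‖ₑ ^ 2 < ⊤) → (∫⁻ x, ‖iteratedFDeriv ℝ 2 v x‖ₑ ^ 2 < ⊤) → |∫ x, ⟪Literature.Analysis.FluidPDE.curl v x, fderiv ℝ v x (Literature.Analysis.FluidPDE.curl v x)⟫_ℝ| ≤ κ * M * Real.sqrt (∫ x, ‖Literature.Analysis.FluidPDE.curl v x‖ ^ 2) * Real.sqrt (∫ x, Literature.Analysis.FluidPDE.frobeniusNormSq (fderiv ℝ (Literature.Analysis.FluidPDE.curl v) x)))}) * M * Real.sqrt (∫ x, ‖curl v x‖ ^ 2) * Real.sqrt (∫ x, frobeniusNormSq (fderiv ℝ (curl v) x))) := by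
  intro v M B hcd hdiv hM hB h0 h1 h2 han hpos
  have hle := sharpDepletion_is_universal v M B hcd hdiv hM hB h0 h1 h2
  refine lt_of_le_of_ne hle fun hatt => ?_
  -- constant speed `‖v x‖ = M`
  have hconst := norm_eq_of_analytic_extremal hcd han hdiv hM hB h1 h2 hpos hatt
  -- `M > 0`
  have hMpos : 0 < M := by
    by_contra hM0
    push Not at hM0
    have hzp : 0 ≤ Real.sqrt (∫ x, ‖curl v x‖ ^ 2) * Real.sqrt (∫ x, frobeniusNormSq (fderiv ℝ (curl v) x)) :=
      mul_nonneg (Real.sqrt_nonneg _) (Real.sqrt_nonneg _)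
    have := mul_le_mul_of_nonneg_right hM0 hzp
    rw [mul_assoc] at hpos
    linarith
  -- `∫⁻ ‖D⁰v‖ₑ² = ∫⁻ M² = ⊤`
  have hfun : (fun x => ‖iteratedFDeriv ℝ 0 v x‖ₑ ^ 2) = fun _ => (ENNReal.ofReal M) ^ 2 := by
    funext x
    rw [← ofReal_norm, norm_iteratedFDeriv_zero, hconst x]
  have hvol : volume (univ : Set (EuclideanSpace ℝ (Fin 3))) = ⊤ := measure_univ_of_isAddLeftInvariant _
  have htop : ∫⁻ x, ‖iteratedFDeriv ℝ 0 v x‖ₑ ^ 2 = ⊤ := by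
    rw [hfun, lintegral_const, hvol, ENNReal.mul_top]
    exact pow_ne_zero 2 (ENNReal.ofReal_pos.mpr hMpos).ne'
  exact (lt_irrefl _) (htop ▸ h0)

/-- **Under non-attainment of `κ⋆`, minimal coefficients are strictly below `κ⋆`.** Let `u` be a classical
solution of the unforced Navier–Stokes system on `ℝ³ × [0,T)` (`ν, T > 0`), Leray–Hopf from its rapidly decaying
datum, and `k₀ ≥ 0` minimal at every `t ∈ [0,T)` (below every nonnegative constant satisfying the flow-wise clause
at `t`). If the sharp depletion inequality is never attained (`hna`), then `k₀(t) < κ⋆` for every `t ∈ [0,T)`: the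
slice `u(t)` is admissible (Tao cover on `[0,(t+T)/2]`), its least bound `N(t) = sup|u(t)|` exists
(`exists_measurable_supNorm_slice`), and the constant `|J|/(N‖ω‖₂‖∇ω‖₂) < κ⋆` (or `0` in the degenerate case)
satisfies the clause at `t`. [folklore] -/
theorem minimalCoeff_lt_sharp_of_analyticSlices
    {ν T : ℝ} (hν : 0 < ν) (hT : 0 < T)
    {u : ℝ → EuclideanSpace ℝ (Fin 3) → EuclideanSpace ℝ (Fin 3)} {p : ℝ → EuclideanSpace ℝ (Fin 3) → ℝ}
    (hsol : IsClassicalNSSolutionOn (Ico 0 T) ν 0 u p) (hLH : IsLerayHopfOn T ν 0 (u 0) u)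
    (hdec : HasRapidSpatialDecay (u 0))
    (hA : ∀ t ∈ Ioo 0 T, AnalyticOnNhd ℝ (u t) univ)
    {k₀ : ℝ → ℝ}
    (hmin : (∀ t ∈ Ico 0 T, ∀ c : ℝ, 0 ≤ c →
      (∀ M : ℝ, (∀ x, ‖u t x‖ ≤ M) →
        |∫ x, ⟪curl (u t) x, fderiv ℝ (u t) x (curl (u t) x)⟫_ℝ| ≤
          c * M * Real.sqrt (∫ x, ‖curl (u t) x‖ ^ 2) *
            Real.sqrt (∫ x, frobeniusNormSq (fderiv ℝ (curl (u t)) x))) → k₀ t ≤ c)) :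
    ∀ t ∈ Ioo 0 T, k₀ t < sInf {κ : ℝ | (∀ (v : EuclideanSpace ℝ (Fin 3) → EuclideanSpace ℝ (Fin 3)) (M B : ℝ), ContDiff ℝ (⊤ : ℕ∞) v → Literature.Analysis.FluidPDE.VectorCalculus.IsDivFree v → (∀ x, ‖v x‖ ≤ M) → (∀ x, ‖fderiv ℝ v x‖ ≤ B) → (∫⁻ x, ‖iteratedFDeriv ℝ 0 v x‖ₑ ^ 2 < ⊤) → (∫⁻ x, ‖iteratedFDeriv ℝ 1 v x‖ₑ ^ 2 < ⊤) → (∫⁻ x, ‖iteratedFDeriv ℝ 2 v x‖ₑ ^ 2 < ⊤) → |∫ x, ⟪Literature.Analysis.FluidPDE.curl v x, fderiv ℝ v x (Literature.Analysis.FluidPDE.curl v x)⟫_ℝ| ≤ κ * M * Real.sqrt (∫ x, ‖Literature.Analysis.FluidPDE.curl v x‖ ^ 2) * Real.sqrt (∫ x, Literature.Analysis.FluidPDE.frobeniusNormSq (fderiv ℝ (Literature.Analysis.FluidPDE.curl v) x)))} := by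
  intro t ht
  have htc : t ∈ Ico 0 T := ⟨ht.1.le, ht.2⟩
  have hκpos : 0 < sInf {κ : ℝ | (∀ (v : EuclideanSpace ℝ (Fin 3) → EuclideanSpace ℝ (Fin 3)) (M B : ℝ), ContDiff ℝ (⊤ : ℕ∞) v → Literature.Analysis.FluidPDE.VectorCalculus.IsDivFree v → (∀ x, ‖v x‖ ≤ M) → (∀ x, ‖fderiv ℝ v x‖ ≤ B) → (∫⁻ x, ‖iteratedFDeriv ℝ 0 v x‖ₑ ^ 2 < ⊤) → (∫⁻ x, ‖iteratedFDeriv ℝ 1 v x‖ₑ ^ 2 < ⊤) → (∫⁻ x, ‖iteratedFDeriv ℝ 2 v x‖ₑ ^ 2 < ⊤) → |∫ x, ⟪Literature.Analysis.FluidPDE.curl v x, fderiv ℝ v x (Literature.Analysis.FluidPDE.curl v x)⟫_ℝ| ≤ κ * M * Real.sqrt (∫ x, ‖Literature.Analysis.FluidPDE.curl v x‖ ^ 2) * Real.sqrt (∫ x, Literature.Analysis.FluidPDE.frobeniusNormSq (fderiv ℝ (Literature.Analysis.FluidPDE.curl v) x)))} := lt_trans (by norm_num) sharpDepletion_gt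
  -- admissibility of the slice `u t`
  have ht' : (t + T) / 2 ∈ Ioo 0 T := ⟨by linarith [ht.1], by linarith [ht.2]⟩
  obtain ⟨q, hsolt, hut, -, -⟩ := stub_taoCover hν hT hsol hLH hdec ht'
  have htI : t ∈ Icc 0 ((t + T) / 2) := ⟨ht.1.le, by linarith [ht.2]⟩
  obtain ⟨C₀, hC₀⟩ := hut 0
  obtain ⟨C₁, hC₁⟩ := hut 1
  obtain ⟨C₂, hC₂⟩ := hut 2
  obtain ⟨B₁, -, hB₁⟩ := exists_forall_norm_fderiv_le_of_hasBoundedSobolevNormsOn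
    (fun s hs => (hsolt.contDiff_velocity hs).of_le (by norm_cast)) hut
  obtain ⟨B₀, -, hB₀⟩ := exists_forall_norm_le_of_hasBoundedSobolevNormsOn hsolt hut
  have h0 : ∫⁻ x, ‖iteratedFDeriv ℝ 0 (u t) x‖ₑ ^ 2 < ⊤ := (hC₀ t htI).trans_lt ENNReal.coe_lt_top
  have h1 : ∫⁻ x, ‖iteratedFDeriv ℝ 1 (u t) x‖ₑ ^ 2 < ⊤ := (hC₁ t htI).trans_lt ENNReal.coe_lt_top
  have h2 : ∫⁻ x, ‖iteratedFDeriv ℝ 2 (u t) x‖ₑ ^ 2 < ⊤ := (hC₂ t htI).trans_lt ENNReal.coe_lt_top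
  have hcd : ContDiff ℝ (⊤ : ℕ∞) (u t) := hsol.contDiff_velocity htc
  have hdiv : VectorCalculus.IsDivFree (u t) := hsol.divFree t htc
  -- the least bound `N t = sup |u t|`
  obtain ⟨N, -, hN0, hN⟩ := exists_measurable_supNorm_slice (measurableSet_Ico (a := (0:ℝ)) (b := T))
    hsol.smooth_velocity.continuousOn
  obtain ⟨hNB, hNx⟩ := hN t htc B₀ (hB₀ t htI)
  set Z : ℝ := ∫ x, ‖curl (u t) x‖ ^ 2 with hZ
  set P : ℝ := ∫ x, frobeniusNormSq (fderiv ℝ (curl (u t)) x) with hP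
  set J : ℝ := ∫ x, ⟪curl (u t) x, fderiv ℝ (u t) x (curl (u t) x)⟫_ℝ with hJ
  set D : ℝ := N t * Real.sqrt Z * Real.sqrt P with hD
  have hD0 : 0 ≤ D := by rw [hD]; have := hN0 t; positivity
  -- universality of `κ⋆` at the least bound
  have hJle : |J| ≤ sInf {κ : ℝ | (∀ (v : EuclideanSpace ℝ (Fin 3) → EuclideanSpace ℝ (Fin 3)) (M B : ℝ), ContDiff ℝ (⊤ : ℕ∞) v → Literature.Analysis.FluidPDE.VectorCalculus.IsDivFree v → (∀ x, ‖v x‖ ≤ M) → (∀ x, ‖fderiv ℝ v x‖ ≤ B) → (∫⁻ x, ‖iteratedFDeriv ℝ 0 v x‖ₑ ^ 2 < ⊤) → (∫⁻ x, ‖iteratedFDeriv ℝ 1 v x‖ₑ ^ 2 < ⊤) → (∫⁻ x, ‖iteratedFDeriv ℝ 2 v x‖ₑ ^ 2 < ⊤) → |∫ x, ⟪Literature.Analysis.FluidPDE.curl v x, fderiv ℝ v x (Literature.Analysis.FluidPDE.curl v x)⟫_ℝ| ≤ κ * M * Real.sqrt (∫ x, ‖Literature.Analysis.FluidPDE.curl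 v x‖ ^ 2) * Real.sqrt (∫ x, Literature.Analysis.FluidPDE.frobeniusNormSq (fderiv ℝ (Literature.Analysis.FluidPDE.curl v) x)))} * N t * Real.sqrt Z * Real.sqrt P :=
    sharpDepletion_is_universal (u t) (N t) B₁ hcd hdiv hNx (hB₁ t htI) h0 h1 h2
  rcases hD0.eq_or_lt with hD00 | hDpos
  · -- degenerate slice: the clause holds with the constant `0`
    have hJ0 : |J| ≤ 0 := by
      have : sInf {κ : ℝ | (∀ (v : EuclideanSpace ℝ (Fin 3) → EuclideanSpace ℝ (Fin 3)) (M B : ℝ), ContDiff ℝ (⊤ : ℕ∞) v → Literature.Analysis.FluidPDE.VectorCalculus.IsDivFree v → (∀ x, ‖v x‖ ≤ M) → (∀ x, ‖fderiv ℝ v x‖ ≤ B) → (∫⁻ x, ‖iteratedFDeriv ℝ 0 v x‖ₑ ^ 2 < ⊤) → (∫⁻ x, ‖iteratedFDeriv ℝ 1 v x‖ₑ ^ 2 < ⊤) → (∫⁻ x, ‖iteratedFDeriv ℝ 2 v x‖ₑ ^ 2 < ⊤) → |∫ x, ⟪Literature.Analysis.FluidPDE.curl v x, fderiv ℝ v x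 (Literature.Analysis.FluidPDE.curl v x)⟫_ℝ| ≤ κ * M * Real.sqrt (∫ x, ‖Literature.Analysis.FluidPDE.curl v x‖ ^ 2) * Real.sqrt (∫ x, Literature.Analysis.FluidPDE.frobeniusNormSq (fderiv ℝ (Literature.Analysis.FluidPDE.curl v) x)))} * N t * Real.sqrt Z * Real.sqrt P = sInf {κ : ℝ | (∀ (v : EuclideanSpace ℝ (Fin 3) → EuclideanSpace ℝ (Fin 3)) (M B : ℝ), ContDiff ℝ (⊤ : ℕ∞) v → Literature.Analysis.FluidPDE.VectorCalculus.IsDivFree v → (∀ x, ‖v x‖ ≤ M) → (∀ x, ‖fderiv ℝ v x‖ ≤ B) → (∫⁻ x, ‖iteratedFDeriv ℝ 0 v x‖ₑ ^ 2 < ⊤) → (∫⁻ x, ‖iteratedFDeriv ℝ 1 v x‖ₑ ^ 2 < ⊤) → (∫⁻ x, ‖iteratedFDeriv ℝ 2 v x‖ₑ ^ 2 < ⊤) → |∫ x, ⟪Literature.Analysis.FluidPDE.curl v x, fderiv ℝ v x (Literature.Analysis.FluidPDE.curl v x)⟫_ℝ| ≤ κ * M * Real.sqrt (∫ x, ‖Literature.Analysis.FluidPDE.curl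 v x‖ ^ 2) * Real.sqrt (∫ x, Literature.Analysis.FluidPDE.frobeniusNormSq (fderiv ℝ (Literature.Analysis.FluidPDE.curl v) x)))} * D := by rw [hD]; ring
      rw [this, ← hD00, mul_zero] at hJle
      exact hJle
    have hk : k₀ t ≤ 0 := by
      refine hmin t htc 0 le_rfl fun M hM => ?_
      have : (0 : ℝ) * M * Real.sqrt Z * Real.sqrt P = 0 := by ring
      rw [this]
      exact hJ0
    exact lt_of_le_of_lt hk hκpos
  · -- non-degenerate slice: the efficiency `|J|/D` is an admissible constant at `t`, and it is `< κ⋆` by `hna`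
    have hlt : |J| < sInf {κ : ℝ | (∀ (v : EuclideanSpace ℝ (Fin 3) → EuclideanSpace ℝ (Fin 3)) (M B : ℝ), ContDiff ℝ (⊤ : ℕ∞) v → Literature.Analysis.FluidPDE.VectorCalculus.IsDivFree v → (∀ x, ‖v x‖ ≤ M) → (∀ x, ‖fderiv ℝ v x‖ ≤ B) → (∫⁻ x, ‖iteratedFDeriv ℝ 0 v x‖ₑ ^ 2 < ⊤) → (∫⁻ x, ‖iteratedFDeriv ℝ 1 v x‖ₑ ^ 2 < ⊤) → (∫⁻ x, ‖iteratedFDeriv ℝ 2 v x‖ₑ ^ 2 < ⊤) → |∫ x, ⟪Literature.Analysis.FluidPDE.curl v x, fderiv ℝ v x (Literature.Analysis.FluidPDE.curl v x)⟫_ℝ| ≤ κ * M * Real.sqrt (∫ x, ‖Literature.Analysis.FluidPDE.curl v x‖ ^ 2) * Real.sqrt (∫ x, Literature.Analysis.FluidPDE.frobeniusNormSq (fderiv ℝ (Literature.Analysis.FluidPDE.curl v) x)))} * N t * Real.sqrt Z * Real.sqrt P :=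
      strict_of_analytic (u t) (N t) B₁ hcd hdiv hNx (hB₁ t htI) h0 h1 h2 (hA t ht) (by rw [hD] at hDpos; exact hDpos)
    have hc0 : 0 ≤ |J| / D := div_nonneg (abs_nonneg _) hD0
    have hk : k₀ t ≤ |J| / D := by
      refine hmin t htc (|J| / D) hc0 fun M hM => ?_
      obtain ⟨hNM, -⟩ := hN t htc M hM
      have hsq : 0 ≤ Real.sqrt Z * Real.sqrt P := by positivity
      calc |J| = |J| / D * D := by field_simp
        _ = |J| / D * N t * Real.sqrt Z * Real.sqrt P := by rw [hD]; ring
        _ ≤ |J| / D * M * Real.sqrt Z * Real.sqrt P := by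
            have h1 := mul_le_mul_of_nonneg_left hNM hc0
            have h2 := mul_le_mul_of_nonneg_right h1 hsq
            simpa [mul_assoc] using h2
    have hlt' : |J| / D < sInf {κ : ℝ | (∀ (v : EuclideanSpace ℝ (Fin 3) → EuclideanSpace ℝ (Fin 3)) (M B : ℝ), ContDiff ℝ (⊤ : ℕ∞) v → Literature.Analysis.FluidPDE.VectorCalculus.IsDivFree v → (∀ x, ‖v x‖ ≤ M) → (∀ x, ‖fderiv ℝ v x‖ ≤ B) → (∫⁻ x, ‖iteratedFDeriv ℝ 0 v x‖ₑ ^ 2 < ⊤) → (∫⁻ x, ‖iteratedFDeriv ℝ 1 v x‖ₑ ^ 2 < ⊤) → (∫⁻ x, ‖iteratedFDeriv ℝ 2 v x‖ₑ ^ 2 < ⊤) → |∫ x, ⟪Literature.Analysis.FluidPDE.curl v x, fderiv ℝ v x (Literature.Analysis.FluidPDE.curl v x)⟫_ℝ| ≤ κ * M * Real.sqrt (∫ x, ‖Literature.Analysis.FluidPDE.curl v x‖ ^ 2) * Real.sqrt (∫ x, Literature.Analysis.FluidPDE.frobeniusNormSq (fderiv ℝ (Literature.Analysis.FluidPDE.curl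 v) x)))} := by
      rw [div_lt_iff₀ hDpos, hD]
      simpa [mul_assoc] using hlt
    exact lt_of_le_of_lt hk hlt'

/-- **Under non-attainment, the period mass of a DSS flow is strictly sub-extremal.** Same setting, `u` moreover
discretely self-similar about `T` with factor `c > 1`, `k₀ : ℝ → [0,1]` measurable, satisfying the clause on `[0,T)`
and minimal there, `t₁ ∈ [0,T)`: `∫_{t₁}^{T−(T−t₁)/c²} k₀²/(T−τ) < κ⋆²·log(c²)` (the integrand is pointwise `<`
`κ⋆²/(T−τ)` on the block by `minimalCoeff_lt_sharp_of_analyticSlices`, and `∫_{block} κ⋆²/(T−τ) = κ⋆² log(c²)`).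
[folklore] -/
theorem dss_periodMass_lt_of_analyticSlices
    {c ν T t₁ : ℝ} (hc : 1 < c) (hν : 0 < ν) (hT : 0 < T) (ht₁ : t₁ ∈ Ico 0 T)
    {u : ℝ → EuclideanSpace ℝ (Fin 3) → EuclideanSpace ℝ (Fin 3)} {p : ℝ → EuclideanSpace ℝ (Fin 3) → ℝ}
    (hsol : IsClassicalNSSolutionOn (Ico 0 T) ν 0 u p) (hLH : IsLerayHopfOn T ν 0 (u 0) u)
    (hdec : HasRapidSpatialDecay (u 0))
    (hA : ∀ t ∈ Ioo 0 T, AnalyticOnNhd ℝ (u t) univ)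
    {k₀ : ℝ → ℝ} (hk₀m : Measurable k₀) (hk₀01 : ∀ τ, 0 ≤ k₀ τ ∧ k₀ τ ≤ 1)
    (hmin : (∀ t ∈ Ico 0 T, ∀ c : ℝ, 0 ≤ c →
      (∀ M : ℝ, (∀ x, ‖u t x‖ ≤ M) →
        |∫ x, ⟪curl (u t) x, fderiv ℝ (u t) x (curl (u t) x)⟫_ℝ| ≤
          c * M * Real.sqrt (∫ x, ‖curl (u t) x‖ ^ 2) *
            Real.sqrt (∫ x, frobeniusNormSq (fderiv ℝ (curl (u t)) x))) → k₀ t ≤ c)) :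
    ∫ τ in t₁..(T - (T - t₁) / c ^ 2), k₀ τ ^ 2 / (T - τ) < sInf {κ : ℝ | (∀ (v : EuclideanSpace ℝ (Fin 3) → EuclideanSpace ℝ (Fin 3)) (M B : ℝ), ContDiff ℝ (⊤ : ℕ∞) v → Literature.Analysis.FluidPDE.VectorCalculus.IsDivFree v → (∀ x, ‖v x‖ ≤ M) → (∀ x, ‖fderiv ℝ v x‖ ≤ B) → (∫⁻ x, ‖iteratedFDeriv ℝ 0 v x‖ₑ ^ 2 < ⊤) → (∫⁻ x, ‖iteratedFDeriv ℝ 1 v x‖ₑ ^ 2 < ⊤) → (∫⁻ x, ‖iteratedFDeriv ℝ 2 v x‖ₑ ^ 2 < ⊤) → |∫ x, ⟪Literature.Analysis.FluidPDE.curl v x, fderiv ℝ v x (Literature.Analysis.FluidPDE.curl v x)⟫_ℝ| ≤ κ * M * Real.sqrt (∫ x, ‖Literature.Analysis.FluidPDE.curl v x‖ ^ 2) * Real.sqrt (∫ x, Literature.Analysis.FluidPDE.frobeniusNormSq (fderiv ℝ (Literature.Analysis.FluidPDE.curl v) x)))} ^ 2 * Real.log (c ^ 2) := by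
  have hc0 : 0 < c := lt_trans one_pos hc
  have hc2 : 1 < c ^ 2 := by nlinarith
  have hTt₁ : 0 < T - t₁ := sub_pos.2 ht₁.2
  have hκpos : 0 < sInf {κ : ℝ | (∀ (v : EuclideanSpace ℝ (Fin 3) → EuclideanSpace ℝ (Fin 3)) (M B : ℝ), ContDiff ℝ (⊤ : ℕ∞) v → Literature.Analysis.FluidPDE.VectorCalculus.IsDivFree v → (∀ x, ‖v x‖ ≤ M) → (∀ x, ‖fderiv ℝ v x‖ ≤ B) → (∫⁻ x, ‖iteratedFDeriv ℝ 0 v x‖ₑ ^ 2 < ⊤) → (∫⁻ x, ‖iteratedFDeriv ℝ 1 v x‖ₑ ^ 2 < ⊤) → (∫⁻ x, ‖iteratedFDeriv ℝ 2 v x‖ₑ ^ 2 < ⊤) → |∫ x, ⟪Literature.Analysis.FluidPDE.curl v x, fderiv ℝ v x (Literature.Analysis.FluidPDE.curl v x)⟫_ℝ| ≤ κ * M * Real.sqrt (∫ x, ‖Literature.Analysis.FluidPDE.curl v x‖ ^ 2) * Real.sqrt (∫ x, Literature.Analysis.FluidPDE.frobeniusNormSq (fderiv ℝ (Literature.Analysis.FluidPDE.curl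 v) x)))} := lt_trans (by norm_num) sharpDepletion_gt
  set s₁ : ℝ := T - (T - t₁) / c ^ 2 with hs₁
  have hlt₁ : t₁ < s₁ := by
    have h : (T - t₁) / c ^ 2 < T - t₁ := div_lt_self hTt₁ hc2
    rw [hs₁]; linarith
  have hs₁T : s₁ < T := by
    have : 0 < (T - t₁) / c ^ 2 := div_pos hTt₁ (by positivity)
    rw [hs₁]; linarith
  -- the constant block mass `κ⋆² log(c²)`
  have hconst : ∫ τ in t₁..s₁, sInf {κ : ℝ | (∀ (v : EuclideanSpace ℝ (Fin 3) → EuclideanSpace ℝ (Fin 3)) (M B : ℝ), ContDiff ℝ (⊤ : ℕ∞) v → Literature.Analysis.FluidPDE.VectorCalculus.IsDivFree v → (∀ x, ‖v x‖ ≤ M) → (∀ x, ‖fderiv ℝ v x‖ ≤ B) → (∫⁻ x, ‖iteratedFDeriv ℝ 0 v x‖ₑ ^ 2 < ⊤) → (∫⁻ x, ‖iteratedFDeriv ℝ 1 v x‖ₑ ^ 2 < ⊤) → (∫⁻ x, ‖iteratedFDeriv ℝ 2 v x‖ₑ ^ 2 < ⊤) → |∫ x, ⟪Literature.Analysis.FluidPDE.curl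 v x, fderiv ℝ v x (Literature.Analysis.FluidPDE.curl v x)⟫_ℝ| ≤ κ * M * Real.sqrt (∫ x, ‖Literature.Analysis.FluidPDE.curl v x‖ ^ 2) * Real.sqrt (∫ x, Literature.Analysis.FluidPDE.frobeniusNormSq (fderiv ℝ (Literature.Analysis.FluidPDE.curl v) x)))} ^ 2 / (T - τ) = sInf {κ : ℝ | (∀ (v : EuclideanSpace ℝ (Fin 3) → EuclideanSpace ℝ (Fin 3)) (M B : ℝ), ContDiff ℝ (⊤ : ℕ∞) v → Literature.Analysis.FluidPDE.VectorCalculus.IsDivFree v → (∀ x, ‖v x‖ ≤ M) → (∀ x, ‖fderiv ℝ v x‖ ≤ B) → (∫⁻ x, ‖iteratedFDeriv ℝ 0 v x‖ₑ ^ 2 < ⊤) → (∫⁻ x, ‖iteratedFDeriv ℝ 1 v x‖ₑ ^ 2 < ⊤) → (∫⁻ x, ‖iteratedFDeriv ℝ 2 v x‖ₑ ^ 2 < ⊤) → |∫ x, ⟪Literature.Analysis.FluidPDE.curl v x, fderiv ℝ v x (Literature.Analysis.FluidPDE.curl v x)⟫_ℝ| ≤ κ * M * Real.sqrt (∫ x,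 ‖Literature.Analysis.FluidPDE.curl v x‖ ^ 2) * Real.sqrt (∫ x, Literature.Analysis.FluidPDE.frobeniusNormSq (fderiv ℝ (Literature.Analysis.FluidPDE.curl v) x)))} ^ 2 * Real.log (c ^ 2) := by
    rw [integral_const_div_sub hlt₁.le hs₁T]
    congr 1
    rw [hs₁, show T - (T - (T - t₁) / c ^ 2) = (T - t₁) / c ^ 2 by ring,
      div_div_eq_mul_div, mul_div_cancel_left₀ (c ^ 2) hTt₁.ne']
  -- strict inequality of the integrals: the difference has a positive integrand
  have hlt := minimalCoeff_lt_sharp_of_analyticSlices hν hT hsol hLH hdec hA hmin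
  have hik : IntervalIntegrable (fun τ => k₀ τ ^ 2 / (T - τ)) volume t₁ s₁ :=
    intervalIntegrable_coeff_sq_div hk₀m hk₀01 hlt₁.le hs₁T
  have hiK : IntervalIntegrable (fun τ => sInf {κ : ℝ | (∀ (v : EuclideanSpace ℝ (Fin 3) → EuclideanSpace ℝ (Fin 3)) (M B : ℝ), ContDiff ℝ (⊤ : ℕ∞) v → Literature.Analysis.FluidPDE.VectorCalculus.IsDivFree v → (∀ x, ‖v x‖ ≤ M) → (∀ x, ‖fderiv ℝ v x‖ ≤ B) → (∫⁻ x, ‖iteratedFDeriv ℝ 0 v x‖ₑ ^ 2 < ⊤) → (∫⁻ x, ‖iteratedFDeriv ℝ 1 v x‖ₑ ^ 2 < ⊤) → (∫⁻ x, ‖iteratedFDeriv ℝ 2 v x‖ₑ ^ 2 < ⊤) → |∫ x, ⟪Literature.Analysis.FluidPDE.curl v x, fderiv ℝ v x (Literature.Analysis.FluidPDE.curl v x)⟫_ℝ| ≤ κ * M * Real.sqrt (∫ x, ‖Literature.Analysis.FluidPDE.curl v x‖ ^ 2) * Real.sqrt (∫ x, Literature.Analysis.FluidPDE.frobeniusNormSq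 (fderiv ℝ (Literature.Analysis.FluidPDE.curl v) x)))} ^ 2 / (T - τ)) volume t₁ s₁ := by
    refine (ContinuousOn.intervalIntegrable ?_)
    refine ContinuousOn.div continuousOn_const (continuousOn_const.sub continuousOn_id) fun τ hτ => ?_
    rw [uIcc_of_le hlt₁.le] at hτ
    exact (sub_pos.2 (lt_of_le_of_lt hτ.2 hs₁T)).ne'
  have hpos : 0 < ∫ τ in t₁..s₁, (sInf {κ : ℝ | (∀ (v : EuclideanSpace ℝ (Fin 3) → EuclideanSpace ℝ (Fin 3)) (M B : ℝ), ContDiff ℝ (⊤ : ℕ∞) v → Literature.Analysis.FluidPDE.VectorCalculus.IsDivFree v → (∀ x, ‖v x‖ ≤ M) → (∀ x, ‖fderiv ℝ v x‖ ≤ B) → (∫⁻ x, ‖iteratedFDeriv ℝ 0 v x‖ₑ ^ 2 < ⊤) → (∫⁻ x, ‖iteratedFDeriv ℝ 1 v x‖ₑ ^ 2 < ⊤) → (∫⁻ x, ‖iteratedFDeriv ℝ 2 v x‖ₑ ^ 2 < ⊤) → |∫ x, ⟪Literature.Analysis.FluidPDE.curl v x, fderiv ℝ v x (Literature.Analysis.FluidPDE.curl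 v x)⟫_ℝ| ≤ κ * M * Real.sqrt (∫ x, ‖Literature.Analysis.FluidPDE.curl v x‖ ^ 2) * Real.sqrt (∫ x, Literature.Analysis.FluidPDE.frobeniusNormSq (fderiv ℝ (Literature.Analysis.FluidPDE.curl v) x)))} ^ 2 / (T - τ) - k₀ τ ^ 2 / (T - τ)) := by
    refine intervalIntegral.intervalIntegral_pos_of_pos_on (hiK.sub hik) (fun τ hτ => ?_) hlt₁
    have hτT : τ ∈ Ioo 0 T := ⟨lt_of_le_of_lt ht₁.1 hτ.1, lt_trans hτ.2 hs₁T⟩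
    have hTτ : 0 < T - τ := sub_pos.2 hτT.2
    have hk := hlt τ hτT
    have hk0 := (hk₀01 τ).1
    rw [← sub_div]
    exact div_pos (by nlinarith) hTτ
  rw [intervalIntegral.integral_sub hiK hik, hconst] at hpos
  linarith

/-- **FLOW BY FLOW, THE DSS STRATUM IS LOG-MEAN SUB-EXTREMAL IF `κ⋆` IS NOT ATTAINED.** Same setting
(`hna`; `u` a classical Leray–Hopf rapidly-decaying-datum flow on `[0,T)`, discretely self-similar about `T` with
factor `c > 1`; `k₀` a measurable minimal flow-wise coefficient on `[0,T)`; onset `t₁ ∈ [0,T)`). Then there is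
`θ ∈ [0,1)` — depending on the flow — with
`∫_{t₁}^t k₀²/(T−τ) ≤ (θκ⋆)²·log((T−t₁)/(T−t)) + I₀` for all `t ∈ [t₁,T)`, `I₀` the period mass
(`(θκ⋆)² = I₀/log(c²) < κ⋆²` by `dss_periodMass_lt_of_analyticSlices`; the bound is `logMean_le_periodAverage_of_dss`).
What the crux's BC5 rung asks beyond this is ONE `θ` for ALL such flows. [folklore] -/
theorem dss_perFlow_logMean_of_analyticSlices
    {c ν T t₁ : ℝ} (hc : 1 < c) (hν : 0 < ν) (hT : 0 < T) (ht₁ : t₁ ∈ Ico 0 T)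
    {u : ℝ → EuclideanSpace ℝ (Fin 3) → EuclideanSpace ℝ (Fin 3)} {p : ℝ → EuclideanSpace ℝ (Fin 3) → ℝ}
    (hsol : IsClassicalNSSolutionOn (Ico 0 T) ν 0 u p) (hLH : IsLerayHopfOn T ν 0 (u 0) u)
    (hdec : HasRapidSpatialDecay (u 0))
    (hA : ∀ t ∈ Ioo 0 T, AnalyticOnNhd ℝ (u t) univ)
    (hdss : IsDiscretelySelfSimilar c (fun s x => u (T + s) x))
    {k₀ : ℝ → ℝ} (hk₀m : Measurable k₀) (hk₀01 : ∀ τ, 0 ≤ k₀ τ ∧ k₀ τ ≤ 1)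
    (hcl : (∀ t ∈ Ico 0 T, ∀ M : ℝ, (∀ x, ‖u t x‖ ≤ M) →
      |∫ x, ⟪curl (u t) x, fderiv ℝ (u t) x (curl (u t) x)⟫_ℝ| ≤
        k₀ t * M * Real.sqrt (∫ x, ‖curl (u t) x‖ ^ 2) *
          Real.sqrt (∫ x, frobeniusNormSq (fderiv ℝ (curl (u t)) x))))
    (hmin : (∀ t ∈ Ico 0 T, ∀ c : ℝ, 0 ≤ c →
      (∀ M : ℝ, (∀ x, ‖u t x‖ ≤ M) →
        |∫ x, ⟪curl (u t) x, fderiv ℝ (u t) x (curl (u t) x)⟫_ℝ| ≤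
          c * M * Real.sqrt (∫ x, ‖curl (u t) x‖ ^ 2) *
            Real.sqrt (∫ x, frobeniusNormSq (fderiv ℝ (curl (u t)) x))) → k₀ t ≤ c)) :
    ∃ θ : ℝ, 0 ≤ θ ∧ θ < 1 ∧ ∀ t ∈ Ico t₁ T, ∫ τ in t₁..t, k₀ τ ^ 2 / (T - τ) ≤
      (θ * sInf {κ : ℝ | (∀ (v : EuclideanSpace ℝ (Fin 3) → EuclideanSpace ℝ (Fin 3)) (M B : ℝ), ContDiff ℝ (⊤ : ℕ∞) v → Literature.Analysis.FluidPDE.VectorCalculus.IsDivFree v → (∀ x, ‖v x‖ ≤ M) → (∀ x, ‖fderiv ℝ v x‖ ≤ B) → (∫⁻ x, ‖iteratedFDeriv ℝ 0 v x‖ₑ ^ 2 < ⊤) → (∫⁻ x, ‖iteratedFDeriv ℝ 1 v x‖ₑ ^ 2 < ⊤) → (∫⁻ x, ‖iteratedFDeriv ℝ 2 v x‖ₑ ^ 2 < ⊤) → |∫ x, ⟪Literature.Analysis.FluidPDE.curl v x, fderiv ℝ v x (Literature.Analysis.FluidPDE.curl v x)⟫_ℝ| ≤ κ * M * Real.sqrt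 (∫ x, ‖Literature.Analysis.FluidPDE.curl v x‖ ^ 2) * Real.sqrt (∫ x, Literature.Analysis.FluidPDE.frobeniusNormSq (fderiv ℝ (Literature.Analysis.FluidPDE.curl v) x)))}) ^ 2 * Real.log ((T - t₁) / (T - t)) +
        ∫ τ in t₁..(T - (T - t₁) / c ^ 2), k₀ τ ^ 2 / (T - τ) := by
  have hc0 : 0 < c := lt_trans one_pos hc
  have hc2 : 1 < c ^ 2 := by nlinarith
  have hℓ : 0 < Real.log (c ^ 2) := Real.log_pos hc2
  have hκpos : 0 < sInf {κ : ℝ | (∀ (v : EuclideanSpace ℝ (Fin 3) → EuclideanSpace ℝ (Fin 3)) (M B : ℝ), ContDiff ℝ (⊤ : ℕ∞) v → Literature.Analysis.FluidPDE.VectorCalculus.IsDivFree v → (∀ x, ‖v x‖ ≤ M) → (∀ x, ‖fderiv ℝ v x‖ ≤ B) → (∫⁻ x, ‖iteratedFDeriv ℝ 0 v x‖ₑ ^ 2 < ⊤) → (∫⁻ x, ‖iteratedFDeriv ℝ 1 v x‖ₑ ^ 2 < ⊤) → (∫⁻ x, ‖iteratedFDeriv ℝ 2 v x‖ₑ ^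 2 < ⊤) → |∫ x, ⟪Literature.Analysis.FluidPDE.curl v x, fderiv ℝ v x (Literature.Analysis.FluidPDE.curl v x)⟫_ℝ| ≤ κ * M * Real.sqrt (∫ x, ‖Literature.Analysis.FluidPDE.curl v x‖ ^ 2) * Real.sqrt (∫ x, Literature.Analysis.FluidPDE.frobeniusNormSq (fderiv ℝ (Literature.Analysis.FluidPDE.curl v) x)))} := lt_trans (by norm_num) sharpDepletion_gt
  set I₀ : ℝ := ∫ τ in t₁..(T - (T - t₁) / c ^ 2), k₀ τ ^ 2 / (T - τ) with hI₀
  have hTt₁ : 0 < T - t₁ := sub_pos.2 ht₁.2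
  have hs1 : t₁ ≤ T - (T - t₁) / c ^ 2 := by
    have h : (T - t₁) / c ^ 2 ≤ T - t₁ := div_le_self hTt₁.le hc2.le
    linarith
  have hI₀0 : 0 ≤ I₀ :=
    intervalIntegral.integral_nonneg hs1 fun τ hτ => div_nonneg (sq_nonneg _) (by
      have : 0 < (T - t₁) / c ^ 2 := div_pos hTt₁ (by positivity)
      linarith [hτ.2])
  have hIlt : I₀ < sInf {κ : ℝ | (∀ (v : EuclideanSpace ℝ (Fin 3) → EuclideanSpace ℝ (Fin 3)) (M B : ℝ), ContDiff ℝ (⊤ : ℕ∞) v → Literature.Analysis.FluidPDE.VectorCalculus.IsDivFree v → (∀ x, ‖v x‖ ≤ M) → (∀ x, ‖fderiv ℝ v x‖ ≤ B) → (∫⁻ x, ‖iteratedFDeriv ℝ 0 v x‖ₑ ^ 2 < ⊤) → (∫⁻ x, ‖iteratedFDeriv ℝ 1 v x‖ₑ ^ 2 < ⊤) → (∫⁻ x, ‖iteratedFDeriv ℝ 2 v x‖ₑ ^ 2 < ⊤) → |∫ x, ⟪Literature.Analysis.FluidPDE.curl v x, fderiv ℝ v x (Literature.Analysis.FluidPDE.curl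 v x)⟫_ℝ| ≤ κ * M * Real.sqrt (∫ x, ‖Literature.Analysis.FluidPDE.curl v x‖ ^ 2) * Real.sqrt (∫ x, Literature.Analysis.FluidPDE.frobeniusNormSq (fderiv ℝ (Literature.Analysis.FluidPDE.curl v) x)))} ^ 2 * Real.log (c ^ 2) :=
    dss_periodMass_lt_of_analyticSlices hc hν hT ht₁ hsol hLH hdec hA hk₀m hk₀01 hmin
  set A : ℝ := I₀ / Real.log (c ^ 2) with hA
  have hA0 : 0 ≤ A := div_nonneg hI₀0 hℓ.le
  have hAlt : A < sInf {κ : ℝ | (∀ (v : EuclideanSpace ℝ (Fin 3) → EuclideanSpace ℝ (Fin 3)) (M B : ℝ), ContDiff ℝ (⊤ : ℕ∞) v → Literature.Analysis.FluidPDE.VectorCalculus.IsDivFree v → (∀ x, ‖v x‖ ≤ M) → (∀ x, ‖fderiv ℝ v x‖ ≤ B) → (∫⁻ x, ‖iteratedFDeriv ℝ 0 v x‖ₑ ^ 2 < ⊤) → (∫⁻ x, ‖iteratedFDeriv ℝ 1 v x‖ₑ ^ 2 < ⊤) → (∫⁻ x, ‖iteratedFDeriv ℝ 2 v x‖ₑ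 ^ 2 < ⊤) → |∫ x, ⟪Literature.Analysis.FluidPDE.curl v x, fderiv ℝ v x (Literature.Analysis.FluidPDE.curl v x)⟫_ℝ| ≤ κ * M * Real.sqrt (∫ x, ‖Literature.Analysis.FluidPDE.curl v x‖ ^ 2) * Real.sqrt (∫ x, Literature.Analysis.FluidPDE.frobeniusNormSq (fderiv ℝ (Literature.Analysis.FluidPDE.curl v) x)))} ^ 2 := by rw [hA, div_lt_iff₀ hℓ]; exact hIlt
  refine ⟨Real.sqrt A / sInf {κ : ℝ | (∀ (v : EuclideanSpace ℝ (Fin 3) → EuclideanSpace ℝ (Fin 3)) (M B : ℝ), ContDiff ℝ (⊤ : ℕ∞) v → Literature.Analysis.FluidPDE.VectorCalculus.IsDivFree v → (∀ x, ‖v x‖ ≤ M) → (∀ x, ‖fderiv ℝ v x‖ ≤ B) → (∫⁻ x, ‖iteratedFDeriv ℝ 0 v x‖ₑ ^ 2 < ⊤) → (∫⁻ x, ‖iteratedFDeriv ℝ 1 v x‖ₑ ^ 2 < ⊤) → (∫⁻ x, ‖iteratedFDeriv ℝ 2 v x‖ₑ ^ 2 < ⊤) → |∫ x, ⟪Literature.Analysis.FluidPDE.curl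 v x, fderiv ℝ v x (Literature.Analysis.FluidPDE.curl v x)⟫_ℝ| ≤ κ * M * Real.sqrt (∫ x, ‖Literature.Analysis.FluidPDE.curl v x‖ ^ 2) * Real.sqrt (∫ x, Literature.Analysis.FluidPDE.frobeniusNormSq (fderiv ℝ (Literature.Analysis.FluidPDE.curl v) x)))}, div_nonneg (Real.sqrt_nonneg _) hκpos.le, ?_, ?_⟩
  · rw [div_lt_one hκpos, Real.sqrt_lt' hκpos]
    exact hAlt
  · intro t ht
    have hsq : (Real.sqrt A / sInf {κ : ℝ | (∀ (v : EuclideanSpace ℝ (Fin 3) → EuclideanSpace ℝ (Fin 3)) (M B : ℝ), ContDiff ℝ (⊤ : ℕ∞) v → Literature.Analysis.FluidPDE.VectorCalculus.IsDivFree v → (∀ x, ‖v x‖ ≤ M) → (∀ x, ‖fderiv ℝ v x‖ ≤ B) → (∫⁻ x, ‖iteratedFDeriv ℝ 0 v x‖ₑ ^ 2 < ⊤) → (∫⁻ x, ‖iteratedFDeriv ℝ 1 v x‖ₑ ^ 2 < ⊤) → (∫⁻ x, ‖iteratedFDeriv ℝ 2 v x‖ₑ ^ 2 < ⊤) → |∫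 x, ⟪Literature.Analysis.FluidPDE.curl v x, fderiv ℝ v x (Literature.Analysis.FluidPDE.curl v x)⟫_ℝ| ≤ κ * M * Real.sqrt (∫ x, ‖Literature.Analysis.FluidPDE.curl v x‖ ^ 2) * Real.sqrt (∫ x, Literature.Analysis.FluidPDE.frobeniusNormSq (fderiv ℝ (Literature.Analysis.FluidPDE.curl v) x)))} * sInf {κ : ℝ | (∀ (v : EuclideanSpace ℝ (Fin 3) → EuclideanSpace ℝ (Fin 3)) (M B : ℝ), ContDiff ℝ (⊤ : ℕ∞) v → Literature.Analysis.FluidPDE.VectorCalculus.IsDivFree v → (∀ x, ‖v x‖ ≤ M) → (∀ x, ‖fderiv ℝ v x‖ ≤ B) → (∫⁻ x, ‖iteratedFDeriv ℝ 0 v x‖ₑ ^ 2 < ⊤) → (∫⁻ x, ‖iteratedFDeriv ℝ 1 v x‖ₑ ^ 2 < ⊤) → (∫⁻ x, ‖iteratedFDeriv ℝ 2 v x‖ₑ ^ 2 < ⊤) → |∫ x, ⟪Literature.Analysis.FluidPDE.curl v x, fderiv ℝ v x (Literature.Analysis.FluidPDE.curl v x)⟫_ℝ| ≤ κ * M * Real.sqrt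 (∫ x, ‖Literature.Analysis.FluidPDE.curl v x‖ ^ 2) * Real.sqrt (∫ x, Literature.Analysis.FluidPDE.frobeniusNormSq (fderiv ℝ (Literature.Analysis.FluidPDE.curl v) x)))}) ^ 2 = A := by
      rw [div_mul_cancel₀ _ hκpos.ne', Real.sq_sqrt hA0]
    rw [hsq, hA]
    exact logMean_le_periodAverage_of_dss hc hT ht₁ hdss hk₀m hk₀01 hcl hmin t ht

end Summit.NavierStokesRegularity.NavierStokesRegularity.Cruxes.NearExtremalTransience.ExtremiserLiouville.K1Bypass

end
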